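/-
Copyright: pub-rosobs cell (Resolution Observatory), carver gen 44.  Companion file; statements OURS, in
the cell's polynomial weighted-centre model `W(f)`.  Instrument — NOT a resolution theorem.
-/
import Literature.AlgebraicGeometry.Resolution.WeightedCentreGraphRestriction
import Literature.AlgebraicGeometry.Resolution.WeightedCentreValuationShear
import HarnessLib

/-!
# The `t^p` count: a centre for `X_a^p + h` in inverse normal form with `x`-entry `> p` carries an arc `c·t^s` on a
# variable of entry `≤ p/s` (Lemma K (i)); with no arc of order `1`, a variable of entry `≤ p/2` (N2)

[ATW24] Abramovich–Temkin–Włodarczyk, *Functorial embedded resolution via weighted blowings up*, Algebra & Number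
Theory 18 (2024): Def. 2.4.1 (2) (p. 1568: a centre `J` is admissible for `f` iff `v_J(f) ≥ 1`), Rem. 5.2.3 (p. 1576:
`Σ dᵢ/aᵢ ≥ 1` on every monomial), Lemma 5.2.6 (p. 1576: `v_J` on sums, products and powers), §5.1 (p. 1575: the
invariant `(a₁ ≤ ⋯ ≤ a_k)`), Thm. 5.3.1 (2) (p. 1578: `inv = max` over the admissible centres).
[CJS20] Cossart–Jannsen–Saito, *Desingularization: invariants and strategy*, LNM 2270 (2020), Def. 1.26 (restriction to a
coordinate subspace = killing variables).

## Setting (polynomial model; `k` a field, variables `Fin N`; NO hypothesis on the characteristic in §§1–3)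

A centre `(Ψ, w)` for `f` (`IsCentreFor`): new parameters `zᵢ = Ψ Xᵢ` through the origin, weights `w ≥ 0`, and
`v_w ≥ 1` on the monomials of `Ψ⁻¹ f` (= `f` written in the parameters `z`).  Fix a variable `a` ("`x`", entry
`b = 1/w_a`, `b = ∞` if `w_a = 0`) and `f = X_a^p + h` with `h` free of `X_a`.  Writing `t := z`-coordinate `a` and
`ε := ` the others, the ambient coordinates expressed in the parameters are `Y i := Ψ⁻¹ Xᵢ`, and `Ψ⁻¹ f = f(Y)`.
The centre is in **inverse normal form** (`IsInverseNormalForm a Y`, engine 1's E1 §2.1 taken as a HYPOTHESIS — the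
polynomial model has no Weierstrass preparation) when `Y a = X a` (`x = t`) and `Y i = X i + X a · R i` for `i ≠ a`
(`Y_i(ε, 0) = ε_i`).  An **arc of order `s` on the variable `i`** is a pure `t`-power `c·t^s`, `c ≠ 0`, of `Y i`:
`coeff (single a s) (Y i) ≠ 0`.

## What is proved (all "(derived here)"; the model statements of E1-PROOF §2.3, §3.3 (i) and REVIEW-E1 N2)

* §1 `IsInverseNormalForm.killHom_aeval` — RESTRICTION `t = 0`: `h(Y)|_{t=0} = h` off `X_a`; hence
  `isAdmissibleFor_of_aeval`: if `w` is admissible for `t^p + h(Y)` (`p ≥ 1`) then `w` is admissible for `h` itself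
  (`supp h ⊆ {β : ⟨β, w⟩ ≥ 1}`), and `IsCentreFor.exps_update_mem_residualInvariants`: the `ε`-entries
  `c = exps (w with w_a := 0)` are a residual invariant of `h` (`c ∈ W-set(h) ⊆ C_q-set(h)` for every `q ≥ 1`), so in
  characteristic `p` the split companion `sort (q, c) ∈ W(X_a^q + h)` (`q = p^n`, Lemma L of `WeightedCentreResidualLower`).
* §2 **`coeff_single_aeval_eq_zero_of_forall_arc` (the `t^p` count)**: if `h` is free of `X_a` and `w`-admissible,
  `Y_i(0) = 0` for `i ≠ a`, and NO variable `i ≠ a` carries an arc of order `s` with `1 ≤ s ≤ p·w_i`, then `h(Y)` has no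
  `t^p` term — every factor `Y_i` of `Y^β` (`β ∈ supp h`, so `β_a = 0`, `⟨β,w⟩ ≥ 1`) has pure-`t` part of order
  `> p·w_i`, so `Y^β` has pure-`t` part of order `> p⟨β, w⟩ ≥ p`.
  **`IsInverseNormalForm.exists_arc_of_isAdmissibleFor`, `IsCentreFor.exists_arc` (Lemma K (i))**: if `w` is admissible
  for `t^p + h(Y)` and `p·w_a < 1` (`x`-entry `b > p`, `t` free allowed), the monomial `t^p` (value `p·w_a < 1`) must
  cancel, so some variable `i ≠ a` carries an arc of order `s ≥ 1` with `s ≤ p·w_i`: entry `aᵢ ≤ p/s`, rate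
  `wᵢ/s − w_a ≥ 1/p − 1/b`.
* §3 **`exists_two_le_of_isAdmissibleFor` (N2)**: if moreover no variable carries an arc of order `1` (E1's I4), that arc
  has `s ≥ 2`, so some `i ≠ a` has `2 ≤ p·wᵢ` — an entry `aᵢ ≤ p/2 < p` (a "block variable").
  **`four_le_of_isAdmissibleFor`**: if in addition every `ε`-entry is `≥ 2` (`wᵢ ≤ 1/2`, E1's I3) then `4 ≤ p`: at
  `p = 2, 3` NO centre in inverse normal form with I3–I4 has `x`-entry `> p`.
* §4 Worked instance (characteristic `p`, `q = p²`): for `F = X₀^{p²} + X₁^p` the Frobenius-folded centre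
  `z₁ = X₁ + X₀^p` (`Y₁ = X₁ − X₀^p`: one arc, of order `p`), weights `(1/(p²+1), 1/p)` (entries `(p²+1, p)`, `x`-entry
  `> q`) IS a centre (`Ψ⁻¹ F = X₁^p`), in inverse normal form with I4; Lemma K (i) at exponent `q` predicts an arc of
  order `s ≤ q·w₁ = p` and the arc found has `s = p` exactly (the bound is attained); N2 predicts `2 ≤ q w₁ = p`.

Value type: typed lemmas in the polynomial `W(f)` model (necessary conditions on bent centres) — not a resolution
theorem.
-/

noncomputable section

open MvPolynomial

namespace Literature.AlgebraicGeometry.Resolution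

namespace WeightedBlowup

variable {k : Type*} [Field k] {N : ℕ}

/-! ## §0 Plumbing -/

/-- A variable absent from `h` has exponent `0` in every monomial of `h` (plumbing). [folklore] -/
private theorem apply_eq_zero_of_notMem_vars₂₆ {h : MvPolynomial (Fin N) k} {a : Fin N} (hh : a ∉ h.vars)
    {β : Fin N →₀ ℕ} (hβ : β ∈ h.support) : β a = 0 := by
  by_contra hne
  exact hh ((mem_vars_iff_mem_support a).mpr ⟨β, hβ, Finsupp.mem_support_iff.mpr hne⟩)

/-- `v_w(X_a^p) = p·w_a` (plumbing). [cite: AbramovichTemkinWlodarczyk2024, Rem. 2.4.2 (p. 1568)] -/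
private theorem monomialValuation_single₂₆ (w : Fin N → ℚ) (a : Fin N) (p : ℕ) :
    monomialValuation w (Finsupp.single a p) = (p : ℚ) * w a := by
  rw [monomialValuation, Finsupp.sum_single_index (by rw [Nat.cast_zero, zero_mul])]

/-- Changing the weight of a variable absent from the monomial does not change its value (plumbing).
[cite: AbramovichTemkinWlodarczyk2024, Rem. 2.4.2 (p. 1568)] -/
private theorem monomialValuation_update_of_apply_eq_zero₂₆ (w : Fin N → ℚ) (a : Fin N) (c : ℚ) {β : Fin N →₀ ℕ}
    (hβ : β a = 0) : monomialValuation (Function.update w a c) β = monomialValuation w β := by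
  unfold monomialValuation
  rw [Finsupp.sum, Finsupp.sum]
  refine Finset.sum_congr rfl fun i hi => ?_
  rw [Function.update_of_ne]
  exact fun hia => (Finsupp.mem_support_iff.mp hi) (hia ▸ hβ)

/-- The `t`-degree as a weight: `weight_{𝟙_a}(d) = d_a` (plumbing). [folklore] -/
private theorem weight_indicator₂₆ (a : Fin N) (d : Fin N →₀ ℕ) :
    Finsupp.weight (fun j => if j = a then 1 else 0) d = d a := by
  classical
  rw [Finsupp.weight_apply, Finsupp.sum]
  simp_rw [smul_eq_mul, mul_ite, mul_one, mul_zero]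
  rw [Finset.sum_ite_eq']
  split_ifs with h
  · rfl
  · exact (Finsupp.notMem_support_iff.mp h).symm

/-- The order of a finite product dominates the sum of the orders (plumbing).
[cite: AbramovichTemkinWlodarczyk2024, Lemma 5.2.6 (p. 1576)] -/
private theorem sum_le_monomialOrd_finset_prod₂₆ {σ : Type*} (w : σ → ℕ) {ι : Type*} (s : Finset ι)
    (P : ι → MvPolynomial σ k) (m : ι → ℕ) (h : ∀ i ∈ s, (m i : ℕ∞) ≤ monomialOrd w (P i)) :
    ((∑ i ∈ s, m i : ℕ) : ℕ∞) ≤ monomialOrd w (∏ i ∈ s, P i) := by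
  classical
  induction s using Finset.induction_on with
  | empty => simp
  | insert j s hjs ih =>
    rw [Finset.sum_insert hjs, Finset.prod_insert hjs, Nat.cast_add]
    exact le_trans (add_le_add (h j (Finset.mem_insert_self j s))
      (ih fun i hi => h i (Finset.mem_insert_of_mem hi))) (add_monomialOrd_le_mul _ _ _)

/-- The order of a finite sum dominates the minimum of the orders (plumbing).
[cite: AbramovichTemkinWlodarczyk2024, Lemma 5.2.6 (p. 1576)] -/
private theorem le_monomialOrd_finset_sum₂₆ {σ : Type*} (w : σ → ℕ) {ι : Type*} (s : Finset ι)
    (P : ι → MvPolynomial σ k) (n : ℕ∞) (h : ∀ i ∈ s, n ≤ monomialOrd w (P i)) :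
    n ≤ monomialOrd w (∑ i ∈ s, P i) := by
  classical
  induction s using Finset.induction_on with
  | empty => simp [monomialOrd_zero]
  | insert j s hjs ih =>
    rw [Finset.sum_insert hjs]
    exact le_trans (le_min (h j (Finset.mem_insert_self j s)) (ih fun i hi => h i (Finset.mem_insert_of_mem hi)))
      (min_monomialOrd_le_add _ _ _)

/-- `Ψ⁻¹ f = f(Y)` with `Y i = Ψ⁻¹ Xᵢ`: `f` written in the regular parameters `zᵢ = Ψ Xᵢ` is `f` evaluated at the
ambient coordinates expressed in the parameters (plumbing: an algebra map out of `k[X]` is evaluation at its values on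
the variables). [cite: AbramovichTemkinWlodarczyk2024, §5.1 (p. 1575) (the ideal written in the parameters of the centre)] -/
theorem algEquiv_symm_eq_aeval (Ψ : MvPolynomial (Fin N) k ≃ₐ[k] MvPolynomial (Fin N) k) (f : MvPolynomial (Fin N) k) :
    Ψ.symm f = aeval (fun i => Ψ.symm (X i)) f :=
  AlgHom.congr_fun (aeval_unique (Ψ.symm : MvPolynomial (Fin N) k →ₐ[k] MvPolynomial (Fin N) k)) f

/-! ## §1 Inverse normal forms and the restriction `t = 0` -/

/-- **Inverse normal form relative to `X_a`** of a family `Y` (`Y i` = the ambient coordinate `yᵢ` written in the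
centre's parameters `t = X_a`, `ε = X_{≠ a}`): `Y a = X a` (`x = t`) and `Y i = X i + X a · R i` for `i ≠ a`
(`Yᵢ(ε, 0) = εᵢ`: every correction term is divisible by `t`).  For a centre `(Ψ, w)` one takes `Y i = Ψ⁻¹ Xᵢ`.
OURS (derived here: engine 1's inverse normal form E1 §2.1, as a hypothesis class of the polynomial model).
[cite: AbramovichTemkinWlodarczyk2024, §5.1 (p. 1575), Thm. 5.3.1 (3) (p. 1578) (independence of the coordinates)] -/
def IsInverseNormalForm (a : Fin N) (Y : Fin N → MvPolynomial (Fin N) k) : Prop :=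
  Y a = X a ∧ ∀ i, i ≠ a → ∃ R : MvPolynomial (Fin N) k, Y i = X i + X a * R

namespace IsInverseNormalForm

variable {a : Fin N} {Y : Fin N → MvPolynomial (Fin N) k}

/-- In inverse normal form every `Y i` vanishes at the origin. (derived here)
[cite: AbramovichTemkinWlodarczyk2024, §5.1 (p. 1575)] -/
theorem constantCoeff_eq_zero (hY : IsInverseNormalForm a Y) (i : Fin N) : constantCoeff (Y i) = 0 := by
  by_cases hi : i = a
  · subst hi
    rw [hY.1, constantCoeff_X]
  · obtain ⟨R, hR⟩ := hY.2 i hi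
    rw [hR, map_add, constantCoeff_X, map_mul, constantCoeff_X, zero_mul, add_zero]

/-- Setting `t = 0` in an inverse normal form returns the coordinate functions: `Y i|_{t=0} = X i|_{t=0}`. (derived here)
[cite: CossartJannsenSaito2020, Def. 1.26] -/
theorem killHom_apply (hY : IsInverseNormalForm a Y) (i : Fin N) :
    killHom {a} (Y i) = if i ∈ ({a} : Finset (Fin N)) then 0 else X i := by
  by_cases hi : i = a
  · subst hi
    rw [hY.1, killHom_X_of_mem (Finset.mem_singleton_self _), if_pos (Finset.mem_singleton_self _)]
  · have hi' : i ∉ ({a} : Finset (Fin N)) := fun h => hi (Finset.mem_singleton.mp h)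
    obtain ⟨R, hR⟩ := hY.2 i hi
    rw [hR, map_add, map_mul, killHom_X_of_mem (Finset.mem_singleton_self _), zero_mul, add_zero,
      killHom_X_of_not_mem hi', if_neg hi']

/-- **RESTRICTION `t = 0`: `h(Y)|_{t=0} = h|_{t=0}`.** (derived here) [cite: CossartJannsenSaito2020, Def. 1.26] -/
theorem killHom_aeval (hY : IsInverseNormalForm a Y) (h : MvPolynomial (Fin N) k) :
    killHom {a} (aeval Y h) = killHom {a} h := by
  have hfun : (fun i => killHom {a} (Y i)) = fun i => if i ∈ ({a} : Finset (Fin N)) then 0 else X i :=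
    funext hY.killHom_apply
  rw [comp_aeval_apply, hfun]
  rfl

/-- Coefficients off `t` are those of `h`: `coeff β (h(Y)) = coeff β h` whenever `β_a = 0`. (derived here)
[cite: CossartJannsenSaito2020, Def. 1.26] -/
theorem coeff_aeval_of_apply_eq_zero (hY : IsInverseNormalForm a Y) (h : MvPolynomial (Fin N) k) {β : Fin N →₀ ℕ}
    (hβ : β a = 0) : coeff β (aeval Y h) = coeff β h := by
  have hβ' : ∀ x ∈ ({a} : Finset (Fin N)), β x = 0 := fun x hx => by
    rw [Finset.mem_singleton.mp hx]; exact hβ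
  rw [← coeff_killHom_of_forall_eq_zero hβ' (aeval Y h), hY.killHom_aeval, coeff_killHom_of_forall_eq_zero hβ']

/-- `f(Y) = t^p + h(Y)` for `f = X_a^p + h` in inverse normal form (`x = t`) (plumbing).
[cite: AbramovichTemkinWlodarczyk2024, §5.1 (p. 1575) (the ideal written in the parameters of the centre)] -/
theorem aeval_X_pow_add (hY : IsInverseNormalForm a Y) (p : ℕ) (h : MvPolynomial (Fin N) k) :
    aeval Y (X a ^ p + h) = X a ^ p + aeval Y h := by
  rw [map_add, map_pow, aeval_X, hY.1]

/-- **RESTRICTION (E1 §2.3): if `w` is admissible for `t^p + h(Y)` (`p ≥ 1`, `h` free of `X_a`), then `w` is admissible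
for `h`** — `supp h ⊆ {β : ⟨β, w⟩ ≥ 1}` (the monomials of `h` survive in `t^p + h(Y)` untouched). (derived here)
[cite: AbramovichTemkinWlodarczyk2024, Def. 2.4.1 (2) (p. 1568), Rem. 5.2.3 (p. 1576)] -/
theorem isAdmissibleFor_of_aeval (hY : IsInverseNormalForm a Y) {p : ℕ} (hp : 0 < p) {h : MvPolynomial (Fin N) k}
    (hh : a ∉ h.vars) {w : Fin N → ℚ} (hadm : IsAdmissibleFor w (X a ^ p + aeval Y h)) : IsAdmissibleFor w h := by
  classical
  intro β hβ
  have hβa : β a = 0 := apply_eq_zero_of_notMem_vars₂₆ hh hβ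
  apply hadm
  rw [mem_support_iff, coeff_add, coeff_X_pow, if_neg, zero_add, hY.coeff_aeval_of_apply_eq_zero h hβa]
  · exact mem_support_iff.mp hβ
  · intro H
    have h1 : (Finsupp.single a p) a = β a := by rw [H]
    rw [Finsupp.single_eq_same, hβa] at h1
    exact hp.ne' h1

end IsInverseNormalForm

/-- **RESTRICTION, residual form (E1 §2.3: `c ∈ W-set(h) ⊆ C_q-set(h)`).** For a centre `(Ψ, w)` of `X_a^p + h`
(`p ≥ 1`, `h` free of `X_a`) in inverse normal form, the `ε`-entries `c = exps (w with w_a := 0)` are a residual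
invariant of `h` relative to `X_a` (witness `γ = 0`), for every exponent `q ≥ 1`. (derived here)
[cite: AbramovichTemkinWlodarczyk2024, §5.1 (p. 1575), Thm. 5.3.1 (2) (p. 1578)] -/
theorem IsCentreFor.exps_update_mem_residualInvariants {p : ℕ} (hp : 0 < p) {a : Fin N} {h : MvPolynomial (Fin N) k}
    (hh : a ∉ h.vars) {Ψ : MvPolynomial (Fin N) k ≃ₐ[k] MvPolynomial (Fin N) k} {w : Fin N → ℚ}
    (hc : IsCentreFor (X a ^ p + h) Ψ w) (hnf : IsInverseNormalForm a fun i => Ψ.symm (X i)) {q : ℕ} (hq : q ≠ 0) :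
    exps (Function.update w a 0) ∈ residualInvariants q a h := by
  obtain ⟨-, hw, hadm⟩ := hc
  rw [algEquiv_symm_eq_aeval, hnf.aeval_X_pow_add] at hadm
  have hadm' : IsAdmissibleFor w h := hnf.isAdmissibleFor_of_aeval hp hh hadm
  refine exps_mem_residualInvariants_of_isAdmissibleFor (γ := 0) (by simp) (map_zero _) (fun x => ?_)
    (Function.update_self a 0 w) ?_
  · by_cases hx : x = a
    · subst hx
      rw [Function.update_self]
    · rw [Function.update_of_ne hx]
      exact hw x
  · rw [zero_pow hq, sub_zero]
    intro β hβ
    rw [monomialValuation_update_of_apply_eq_zero₂₆ w a 0 (apply_eq_zero_of_notMem_vars₂₆ hh hβ)]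
    exact hadm' β hβ

section CharP

variable (p n : ℕ) [hp : Fact p.Prime] [CharP k p]

/-- **… hence the split companion** (Lemma L of `WeightedCentreResidualLower`): in characteristic `p`, `q = p^n`, for a
centre `(Ψ, w)` of `X_a^q + h` in inverse normal form with `ε`-entries `c`, the invariant `sort (q, c)` of the split
product centre lies in `W(X_a^q + h)`. (derived here)
[cite: AbramovichTemkinWlodarczyk2024, Lemma 5.2.6 (p. 1576), Thm. 5.3.1 (2)–(3) (p. 1578)] -/
theorem IsCentreFor.insertionSort_cons_exps_update_mem_admissibleInvariants {a : Fin N} {h : MvPolynomial (Fin N) k}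
    (hh : a ∉ h.vars) {Ψ : MvPolynomial (Fin N) k ≃ₐ[k] MvPolynomial (Fin N) k} {w : Fin N → ℚ}
    (hc : IsCentreFor (X a ^ p ^ n + h) Ψ w) (hnf : IsInverseNormalForm a fun i => Ψ.symm (X i)) :
    (((p ^ n : ℕ) : ℚ) :: exps (Function.update w a 0)).insertionSort (· ≤ ·) ∈
      admissibleInvariants (X a ^ p ^ n + h) :=
  insertionSort_cons_mem_admissibleInvariants_X_pow_add p n a hh
    (hc.exps_update_mem_residualInvariants (pow_pos hp.out.pos n) hh hnf (pow_ne_zero n hp.out.ne_zero))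

end CharP

/-! ## §2 The `t^p` count (Lemma K (i)) -/

/-- **The `t^p` count.**  Let `h` be free of `X_a` and `w`-admissible, let `Y_i(0) = 0` for `i ≠ a`, and suppose NO
variable `i ≠ a` carries an arc `c·t^s` (`c = coeff (single a s) (Y i) ≠ 0`) of order `1 ≤ s ≤ p·wᵢ`.  Then `h(Y)`
has no `t^p` term.  Proof: only the pure-`t` parts `A i = Y i|_{ε=0}` contribute to pure `t`-powers of `h(Y)`;
`ord_t (A i) ≥ ⌊p wᵢ⌋ + 1 > p wᵢ` for `i ≠ a`; for `β ∈ supp h` (`β_a = 0`, `β ≠ 0`, `⟨β,w⟩ ≥ 1`):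
`ord_t (A^β) ≥ Σ βᵢ(⌊p wᵢ⌋ + 1) > p⟨β, w⟩ ≥ p`. (derived here)
[cite: AbramovichTemkinWlodarczyk2024, Lemma 5.2.6 (p. 1576), Rem. 5.2.3 (p. 1576)] -/
theorem coeff_single_aeval_eq_zero_of_forall_arc {a : Fin N} {h : MvPolynomial (Fin N) k} (hh : a ∉ h.vars)
    {w : Fin N → ℚ} (hadm : IsAdmissibleFor w h) {Y : Fin N → MvPolynomial (Fin N) k}
    (hY0 : ∀ i, i ≠ a → constantCoeff (Y i) = 0) {p : ℕ}
    (harc : ∀ i, i ≠ a → ∀ s : ℕ, 0 < s → (s : ℚ) ≤ p * w i → coeff (Finsupp.single a s) (Y i) = 0) :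
    coeff (Finsupp.single a p) (aeval Y h) = 0 := by
  classical
  -- the surviving variable `t = X_a`, the killed ones `H = {i ≠ a}`, the `t`-degree `u`, the bounds `m`
  let H : Finset (Fin N) := Finset.univ.erase a
  let A : Fin N → MvPolynomial (Fin N) k := fun i => killHom H (Y i)
  let u : Fin N → ℕ := fun j => if j = a then 1 else 0
  let m : Fin N → ℕ := fun i => ⌊(p : ℚ) * w i⌋₊ + 1
  have hsingle : ∀ s : ℕ, ∀ x ∈ H, (Finsupp.single a s) x = 0 := fun s x hx => by
    rw [Finsupp.single_apply, if_neg (Finset.ne_of_mem_erase hx).symm]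
  -- (1) the `t^p` coefficient of `h(Y)` is that of `h(A)`
  have h1 : coeff (Finsupp.single a p) (aeval Y h) = coeff (Finsupp.single a p) (aeval A h) := by
    rw [← coeff_killHom_of_forall_eq_zero (hsingle p) (aeval Y h), comp_aeval_apply]
  -- (2) `ord_t (A i) ≥ m i` for `i ≠ a`
  have h2 : ∀ i, i ≠ a → ((m i : ℕ) : ℕ∞) ≤ monomialOrd u (A i) := by
    intro i hi
    rw [le_monomialOrd_iff]
    intro d hd
    have hd' : ∀ x, x ≠ a → d x = 0 := fun x hx => by
      by_contra hne
      exact (mem_support_iff.mp hd)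
        (coeff_killHom_of_ne_zero (Finset.mem_erase.mpr ⟨hx, Finset.mem_univ x⟩) hne _)
    have hdeq : d = Finsupp.single a (d a) := by
      ext x
      by_cases hx : x = a
      · subst hx
        rw [Finsupp.single_eq_same]
      · rw [hd' x hx, Finsupp.single_apply, if_neg (Ne.symm hx)]
    have hcoeff : coeff (Finsupp.single a (d a)) (Y i) ≠ 0 := by
      rw [← coeff_killHom_of_forall_eq_zero (hsingle (d a)) (Y i), ← hdeq]
      exact mem_support_iff.mp hd
    have hda : 0 < d a := by
      rw [pos_iff_ne_zero]
      intro h0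
      rw [h0, Finsupp.single_zero] at hcoeff
      apply hcoeff
      have := hY0 i hi
      rwa [constantCoeff_eq] at this
    have hlt : (p : ℚ) * w i < d a := by
      by_contra hle
      exact hcoeff (harc i hi (d a) hda (not_lt.mp hle))
    rw [weight_indicator₂₆]
    exact Nat.succ_le_of_lt ((Nat.floor_lt' hda.ne').mpr hlt)
  -- (3) `ord_t` of each term `h_β · A^β`, `β ∈ supp h`, is `≥ p + 1`
  have h3 : ∀ β ∈ h.support, ((p + 1 : ℕ) : ℕ∞) ≤ monomialOrd u (aeval A (monomial β (coeff β h))) := by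
    intro β hβ
    have hβa : β a = 0 := apply_eq_zero_of_notMem_vars₂₆ hh hβ
    have hβsupp : ∀ i ∈ β.support, i ≠ a := fun i hi hia =>
      (Finsupp.mem_support_iff.mp hi) (hia ▸ hβa)
    have hcount : p + 1 ≤ ∑ i ∈ β.support, β i * m i := by
      have hval : (1 : ℚ) ≤ monomialValuation w β := hadm β hβ
      have hne : β.support.Nonempty := by
        rw [Finset.nonempty_iff_ne_empty, Ne, Finsupp.support_eq_empty]
        rintro rfl
        rw [monomialValuation, Finsupp.sum_zero_index] at hval
        exact absurd hval (by norm_num)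
      have hlt : ∑ i ∈ β.support, (β i : ℚ) * ((p : ℚ) * w i) < ∑ i ∈ β.support, (β i : ℚ) * (m i : ℚ) := by
        apply Finset.sum_lt_sum_of_nonempty hne
        intro i hi
        have hβi : (0 : ℚ) < β i := by exact_mod_cast Nat.pos_of_ne_zero (Finsupp.mem_support_iff.mp hi)
        refine mul_lt_mul_of_pos_left ?_ hβi
        show (p : ℚ) * w i < ((⌊(p : ℚ) * w i⌋₊ + 1 : ℕ) : ℚ)
        push_cast
        exact Nat.lt_floor_add_one _
      have hsum : ∑ i ∈ β.support, (β i : ℚ) * ((p : ℚ) * w i) = p * monomialValuation w β := by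
        rw [monomialValuation, Finsupp.sum, Finset.mul_sum]
        exact Finset.sum_congr rfl fun i _ => by ring
      have hq : (p : ℚ) < ((∑ i ∈ β.support, β i * m i : ℕ) : ℚ) :=
        calc (p : ℚ) = p * 1 := (mul_one _).symm
          _ ≤ p * monomialValuation w β := mul_le_mul_of_nonneg_left hval (Nat.cast_nonneg p)
          _ = ∑ i ∈ β.support, (β i : ℚ) * ((p : ℚ) * w i) := hsum.symm
          _ < ∑ i ∈ β.support, (β i : ℚ) * (m i : ℚ) := hlt
          _ = ((∑ i ∈ β.support, β i * m i : ℕ) : ℚ) := by push_cast; rfl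
      exact_mod_cast hq
    have hprod : ((∑ i ∈ β.support, β i * m i : ℕ) : ℕ∞) ≤ monomialOrd u (β.prod fun i e => A i ^ e) := by
      rw [Finsupp.prod]
      refine sum_le_monomialOrd_finset_prod₂₆ u β.support (fun i => A i ^ β i) (fun i => β i * m i)
        fun i hi => ?_
      calc ((β i * m i : ℕ) : ℕ∞) = β i • ((m i : ℕ) : ℕ∞) := by rw [nsmul_eq_mul, Nat.cast_mul]
        _ ≤ β i • monomialOrd u (A i) := nsmul_le_nsmul_right (h2 i (hβsupp i hi)) _
        _ ≤ monomialOrd u (A i ^ β i) := nsmul_monomialOrd_le_pow u (A i) (β i)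
    rw [aeval_monomial, algebraMap_eq]
    calc ((p + 1 : ℕ) : ℕ∞) ≤ ((∑ i ∈ β.support, β i * m i : ℕ) : ℕ∞) := by exact_mod_cast hcount
      _ ≤ monomialOrd u (β.prod fun i e => A i ^ e) := hprod
      _ ≤ monomialOrd u (C (coeff β h)) + monomialOrd u (β.prod fun i e => A i ^ e) := le_add_self
      _ ≤ monomialOrd u (C (coeff β h) * β.prod fun i e => A i ^ e) := add_monomialOrd_le_mul u _ _
  -- (4) hence `ord_t h(A) ≥ p + 1`
  have h4 : ((p + 1 : ℕ) : ℕ∞) ≤ monomialOrd u (aeval A h) := by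
    conv_rhs => rw [h.as_sum, map_sum]
    exact le_monomialOrd_finset_sum₂₆ u h.support _ _ h3
  -- (5) so `t^p` does not occur
  rw [h1]
  by_contra hne
  have hle := h4.trans (monomialOrd_le_weight u (mem_support_iff.mpr hne))
  rw [weight_indicator₂₆, Finsupp.single_eq_same] at hle
  have : p + 1 ≤ p := by exact_mod_cast hle
  omega

namespace IsInverseNormalForm

variable {a : Fin N} {Y : Fin N → MvPolynomial (Fin N) k}

/-- **Lemma K (i) (E1 §3.3 (i); INVARIANTS §5b), family form.**  If `w` is admissible for `G = t^p + h(Y)` (`p ≥ 1`,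
`h` free of `X_a`, `Y` in inverse normal form) and `p·w_a < 1` (the `x`-entry `b = 1/w_a` exceeds `p`; `t` free,
`w_a = 0`, allowed), then some variable `i ≠ a` carries an arc `c·t^s`, `s ≥ 1`, with `s ≤ p·wᵢ` — entry
`aᵢ ≤ p/s`, rate `wᵢ/s − w_a ≥ 1/p − 1/b`.  (The monomial `t^p` has value `p·w_a < 1`, so it cancels in `G`:
`coeff_{t^p} h(Y) = −1 ≠ 0`; now apply the `t^p` count.) (derived here)
[cite: AbramovichTemkinWlodarczyk2024, Def. 2.4.1 (2) (p. 1568), Rem. 5.2.3 (p. 1576), Lemma 5.2.6 (p. 1576)] -/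
theorem exists_arc_of_isAdmissibleFor (hY : IsInverseNormalForm a Y) {p : ℕ} (hp : 0 < p)
    {h : MvPolynomial (Fin N) k} (hh : a ∉ h.vars) {w : Fin N → ℚ}
    (hadm : IsAdmissibleFor w (X a ^ p + aeval Y h)) (hb : (p : ℚ) * w a < 1) :
    ∃ i, i ≠ a ∧ ∃ s : ℕ, 0 < s ∧ coeff (Finsupp.single a s) (Y i) ≠ 0 ∧ (s : ℚ) ≤ p * w i := by
  classical
  by_contra hno
  have harc : ∀ i, i ≠ a → ∀ s : ℕ, 0 < s → (s : ℚ) ≤ p * w i → coeff (Finsupp.single a s) (Y i) = 0 := by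
    intro i hi s hs hle
    by_contra hne
    exact hno ⟨i, hi, s, hs, hne, hle⟩
  have hzero : coeff (Finsupp.single a p) (aeval Y h) = 0 :=
    coeff_single_aeval_eq_zero_of_forall_arc hh (hY.isAdmissibleFor_of_aeval hp hh hadm)
      (fun i _ => hY.constantCoeff_eq_zero i) harc
  have hG : coeff (Finsupp.single a p) (X a ^ p + aeval Y h) = 0 := by
    by_contra hne
    have h1 := hadm _ (mem_support_iff.mpr hne)
    rw [monomialValuation_single₂₆] at h1
    exact (not_lt.mpr h1) hb
  rw [coeff_add, coeff_X_pow, if_pos rfl, hzero, add_zero] at hG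
  exact one_ne_zero hG

/-! ## §3 N2: a block variable exists -/

/-- **N2 (REVIEW-E1 §3: a block variable exists), family form.**  If moreover NO variable `i ≠ a` carries an arc of
order `1` (E1's I4: `coeff (single a 1) (Y i) = 0` — an order-`1` arc would make `zᵢ` `x`-regular), then the arc of
Lemma K (i) has order `s ≥ 2`, so some `i ≠ a` has `2 ≤ p·wᵢ`: entry `aᵢ ≤ p/2 < p`. (derived here)
[cite: AbramovichTemkinWlodarczyk2024, Def. 2.4.1 (2) (p. 1568), Rem. 5.2.3 (p. 1576)] -/
theorem exists_two_le_of_isAdmissibleFor (hY : IsInverseNormalForm a Y) {p : ℕ} (hp : 0 < p)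
    {h : MvPolynomial (Fin N) k} (hh : a ∉ h.vars) {w : Fin N → ℚ}
    (hadm : IsAdmissibleFor w (X a ^ p + aeval Y h)) (hb : (p : ℚ) * w a < 1)
    (hI4 : ∀ i, i ≠ a → coeff (Finsupp.single a 1) (Y i) = 0) : ∃ i, i ≠ a ∧ (2 : ℚ) ≤ p * w i := by
  obtain ⟨i, hi, s, hs, hc, hle⟩ := hY.exists_arc_of_isAdmissibleFor hp hh hadm hb
  refine ⟨i, hi, le_trans ?_ hle⟩
  have hs2 : 2 ≤ s := by
    by_contra hlt
    obtain rfl : s = 1 := by omega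
    exact hc (hI4 i hi)
  exact_mod_cast hs2

/-- **No bent inverse normal form with `x`-entry `> p` at `p ≤ 3`.**  Under I4 and `wᵢ ≤ 1/2` for all `i ≠ a` (every
`ε`-entry `≥ 2`, E1's I3), admissibility of `w` for `t^p + h(Y)` with `p·w_a < 1` forces `4 ≤ p`
(`2 ≤ p wᵢ ≤ p/2`).  So at `p = 2, 3` every centre for `X_a^p + h` in inverse normal form with I3–I4 has `x`-entry
`b ≤ p` (E1 at `p = 2, 3` needs no bent-centre analysis). (derived here)
[cite: AbramovichTemkinWlodarczyk2024, Def. 2.4.1 (2) (p. 1568), Rem. 5.2.3 (p. 1576)] -/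
theorem four_le_of_isAdmissibleFor (hY : IsInverseNormalForm a Y) {p : ℕ} (hp : 0 < p)
    {h : MvPolynomial (Fin N) k} (hh : a ∉ h.vars) {w : Fin N → ℚ}
    (hadm : IsAdmissibleFor w (X a ^ p + aeval Y h)) (hb : (p : ℚ) * w a < 1)
    (hI4 : ∀ i, i ≠ a → coeff (Finsupp.single a 1) (Y i) = 0) (hI3 : ∀ i, i ≠ a → w i ≤ 1 / 2) : 4 ≤ p := by
  obtain ⟨i, hi, h2⟩ := hY.exists_two_le_of_isAdmissibleFor hp hh hadm hb hI4
  have h3 : (2 : ℚ) ≤ p * (1 / 2) := h2.trans (mul_le_mul_of_nonneg_left (hI3 i hi) (Nat.cast_nonneg p))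
  have h4 : (4 : ℚ) ≤ p := by linarith
  exact_mod_cast h4

end IsInverseNormalForm

/-- **Lemma K (i), centre side.**  A centre `(Ψ, w)` for `X_a^p + h` (`p ≥ 1`, `h` free of `X_a`) in inverse normal
form with `x`-entry `> p` (`p·w_a < 1`) carries an arc `c·t^s` (`s ≥ 1`) on some parameter `zᵢ`, `i ≠ a`, of entry
`aᵢ = 1/wᵢ ≤ p/s`. (derived here)
[cite: AbramovichTemkinWlodarczyk2024, Def. 2.4.1 (2) (p. 1568), Rem. 5.2.3 (p. 1576), Thm. 5.3.1 (2) (p. 1578)] -/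
theorem IsCentreFor.exists_arc {p : ℕ} (hp : 0 < p) {a : Fin N} {h : MvPolynomial (Fin N) k} (hh : a ∉ h.vars)
    {Ψ : MvPolynomial (Fin N) k ≃ₐ[k] MvPolynomial (Fin N) k} {w : Fin N → ℚ} (hc : IsCentreFor (X a ^ p + h) Ψ w)
    (hnf : IsInverseNormalForm a fun i => Ψ.symm (X i)) (hb : (p : ℚ) * w a < 1) :
    ∃ i, i ≠ a ∧ ∃ s : ℕ, 0 < s ∧ coeff (Finsupp.single a s) (Ψ.symm (X i)) ≠ 0 ∧ (s : ℚ) ≤ p * w i := by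
  obtain ⟨-, -, hadm⟩ := hc
  rw [algEquiv_symm_eq_aeval, hnf.aeval_X_pow_add] at hadm
  exact hnf.exists_arc_of_isAdmissibleFor hp hh hadm hb

/-- **N2, centre side.**  With I4 (no parameter carries an arc of order `1`), a centre for `X_a^p + h` in inverse
normal form with `x`-entry `> p` has a parameter `zᵢ`, `i ≠ a`, of entry `aᵢ ≤ p/2`. (derived here)
[cite: AbramovichTemkinWlodarczyk2024, Def. 2.4.1 (2) (p. 1568), Thm. 5.3.1 (2) (p. 1578)] -/
theorem IsCentreFor.exists_two_le {p : ℕ} (hp : 0 < p) {a : Fin N} {h : MvPolynomial (Fin N) k} (hh : a ∉ h.vars)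
    {Ψ : MvPolynomial (Fin N) k ≃ₐ[k] MvPolynomial (Fin N) k} {w : Fin N → ℚ} (hc : IsCentreFor (X a ^ p + h) Ψ w)
    (hnf : IsInverseNormalForm a fun i => Ψ.symm (X i)) (hb : (p : ℚ) * w a < 1)
    (hI4 : ∀ i, i ≠ a → coeff (Finsupp.single a 1) (Ψ.symm (X i)) = 0) : ∃ i, i ≠ a ∧ (2 : ℚ) ≤ p * w i := by
  obtain ⟨-, -, hadm⟩ := hc
  rw [algEquiv_symm_eq_aeval, hnf.aeval_X_pow_add] at hadm
  exact hnf.exists_two_le_of_isAdmissibleFor hp hh hadm hb hI4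

/-! ## §4 Worked instance: the Frobenius-folded centre `z₁ = X₁ + X₀^p` for `X₀^{p²} + X₁^p` (characteristic `p`) -/

section Instance

variable (p : ℕ)

/-- `X₁` does not occur in `X₀^p`, nor `X₀` in `X₁^p` (plumbing). [folklore] -/
private theorem notMem_vars_X_pow₂₆ {i j : Fin 2} (hij : i ≠ j) : i ∉ (X j ^ p : MvPolynomial (Fin 2) k).vars :=
  fun h => by
    have := vars_pow (X j : MvPolynomial (Fin 2) k) p h
    rw [vars_X] at this
    exact hij (Finset.mem_singleton.mp this)

/-- The folded parameters: `z₀ = X₀`, `z₁ = X₁ + X₀^p`; so `Y₁ = Ψ⁻¹ X₁ = X₁ − X₀^p` (one arc, of order `p`).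
(derived here) [cite: AbramovichTemkinWlodarczyk2024, §5.1 (p. 1575)] -/
theorem addPolyShear_symm_X_one_fold :
    (addPolyShear (1 : Fin 2) (X 0 ^ p : MvPolynomial (Fin 2) k)).symm (X 1) = X 1 - X 0 ^ p := by
  simp [addPolyShear, sub_eq_add_neg, killVar_eq_self_of_notMem (notMem_vars_X_pow₂₆ (k := k) p one_ne_zero)]

/-- The other parameter is untouched: `Ψ⁻¹ X₀ = X₀`. (derived here) [cite: AbramovichTemkinWlodarczyk2024, §5.1 (p. 1575)] -/
theorem addPolyShear_symm_X_zero_fold :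
    (addPolyShear (1 : Fin 2) (X 0 ^ p : MvPolynomial (Fin 2) k)).symm (X 0) = X 0 := by
  simp [addPolyShear]

/-- The arcs of the fold: `Y₁ = X₁ − X₀^p` carries `−t^p` (order `p`) and, for `p ≠ 1`, no arc of order `1` (I4).
(derived here) [cite: AbramovichTemkinWlodarczyk2024, §5.1 (p. 1575)] -/
theorem coeff_single_addPolyShear_symm_X_one_fold (s : ℕ) :
    coeff (Finsupp.single 0 s) ((addPolyShear (1 : Fin 2) (X 0 ^ p : MvPolynomial (Fin 2) k)).symm (X 1)) =
      if s = p then -1 else 0 := by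
  classical
  rw [addPolyShear_symm_X_one_fold, coeff_sub, coeff_X, coeff_X_pow, if_neg]
  · by_cases hs : s = p
    · subst hs
      rw [if_pos rfl, if_pos rfl, zero_sub]
    · rw [if_neg, if_neg hs, sub_zero]
      intro h
      have := congrArg (· 0) h
      simp only [Finsupp.single_eq_same] at this
      exact hs this.symm
  · intro h
    have := congrArg (· 1) h
    simp at this

variable [hp : Fact p.Prime]

/-- The folded centre is in inverse normal form relative to `X₀`: `Y₀ = X₀`, `Y₁ = X₁ + X₀·(−X₀^{p−1})`. (derived here)
[cite: AbramovichTemkinWlodarczyk2024, §5.1 (p. 1575)] -/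
theorem isInverseNormalForm_fold :
    IsInverseNormalForm 0 fun i => (addPolyShear (1 : Fin 2) (X 0 ^ p : MvPolynomial (Fin 2) k)).symm (X i) := by
  refine ⟨addPolyShear_symm_X_zero_fold p, fun i hi => ?_⟩
  obtain rfl : i = 1 := by
    rcases Fin.exists_fin_two.mp ⟨i, rfl⟩ with h | h
    · exact absurd h hi
    · exact h
  refine ⟨-X 0 ^ (p - 1), ?_⟩
  show (addPolyShear (1 : Fin 2) (X 0 ^ p : MvPolynomial (Fin 2) k)).symm (X 1) = _
  rw [addPolyShear_symm_X_one_fold, mul_neg, ← pow_succ', Nat.sub_add_cancel hp.out.one_le, sub_eq_add_neg]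

variable [CharP k p]

/-- **In characteristic `p`, `Ψ⁻¹(X₀^{p²} + X₁^p) = X₁^p`** for the fold `Ψ`: `X₀^{p²} + (X₁ − X₀^p)^p = X₁^p`.
(derived here) [cite: AbramovichTemkinWlodarczyk2024, §5.1 (p. 1575)] -/
theorem addPolyShear_symm_fold :
    (addPolyShear (1 : Fin 2) (X 0 ^ p : MvPolynomial (Fin 2) k)).symm (X 0 ^ (p ^ 2) + X 1 ^ p) = X 1 ^ p := by
  rw [map_add, map_pow, map_pow, addPolyShear_symm_X_zero_fold, addPolyShear_symm_X_one_fold,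
    sub_pow_char (p := p) (X 1 : MvPolynomial (Fin 2) k) (X 0 ^ p), ← pow_mul, ← pow_two]
  ring

/-- **The folded centre `(z₀, z₁; 1/(p²+1), 1/p)` — entries `(p²+1, p)`, `x`-entry `p² + 1 > q = p²` — IS a centre for
`X₀^{p²} + X₁^p`** (`Ψ⁻¹ F = X₁^p` has the single monomial `X₁^p`, of value `1`). (derived here)
[cite: AbramovichTemkinWlodarczyk2024, Def. 2.4.1 (2) (p. 1568), Rem. 5.2.3 (p. 1576)] -/
theorem isCentreFor_fold :
    IsCentreFor (X 0 ^ (p ^ 2) + X 1 ^ p : MvPolynomial (Fin 2) k) (addPolyShear (1 : Fin 2) (X 0 ^ p))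
      ![1 / ((p : ℚ) ^ 2 + 1), 1 / p] := by
  classical
  refine ⟨fun i => ?_, fun i => ?_, ?_⟩
  · refine constantCoeff_addPolyShear_X 1 ?_ i
    rw [map_pow, constantCoeff_X, zero_pow hp.out.ne_zero]
  · rcases Fin.exists_fin_two.mp ⟨i, rfl⟩ with h | h <;> rw [h] <;> simp; positivity
  · rw [addPolyShear_symm_fold]
    intro d hd
    rw [X_pow_eq_monomial, support_monomial, if_neg one_ne_zero, Finset.mem_singleton] at hd
    subst hd
    have hp0 : (p : ℚ) ≠ 0 := by exact_mod_cast hp.out.ne_zero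
    have h1 : (![1 / ((p : ℚ) ^ 2 + 1), 1 / p] : Fin 2 → ℚ) 1 = 1 / p := rfl
    rw [monomialValuation, Finsupp.sum_single_index (by rw [Nat.cast_zero, zero_mul]), h1, one_div,
      mul_inv_cancel₀ hp0]

/-- Lemma K (i) applied to the fold at exponent `q = p²` (its `x`-entry hypothesis `q·w₀ = p²/(p²+1) < 1` holds):
there is an arc of order `s` with `1 ≤ s ≤ q·w₁ = p` on `z₁` — non-vacuity of the lemma on a bent centre with `x`-entry
`> q`. (derived here) [cite: AbramovichTemkinWlodarczyk2024, Def. 2.4.1 (2) (p. 1568), Thm. 5.3.1 (2) (p. 1578)] -/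
example : ∃ i, i ≠ (0 : Fin 2) ∧ ∃ s : ℕ, 0 < s ∧
    coeff (Finsupp.single 0 s) ((addPolyShear (1 : Fin 2) (X 0 ^ p : MvPolynomial (Fin 2) k)).symm (X i)) ≠ 0 ∧
      (s : ℚ) ≤ (p ^ 2 : ℕ) * (![1 / ((p : ℚ) ^ 2 + 1), 1 / p] : Fin 2 → ℚ) i := by
  refine (isCentreFor_fold (k := k) p).exists_arc (pow_pos hp.out.pos 2) (notMem_vars_X_pow₂₆ p zero_ne_one)
    (isInverseNormalForm_fold p) ?_
  have hp0 : (0 : ℚ) < (p : ℚ) ^ 2 + 1 := by positivity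
  have h0 : (![1 / ((p : ℚ) ^ 2 + 1), 1 / p] : Fin 2 → ℚ) 0 = 1 / ((p : ℚ) ^ 2 + 1) := rfl
  rw [h0, Nat.cast_pow, one_div, ← div_eq_mul_inv, div_lt_one hp0]
  exact lt_add_one _

/-- … and the arc the lemma promises is the one we see: `Y₁ = X₁ − X₀^p` carries `−t^p`, of order `s = p = q·w₁`
EXACTLY (the bound `s ≤ q·wᵢ` of Lemma K (i) is attained), and no arc of order `1` (I4 holds, `p ≥ 2`), in line with
N2's conclusion `2 ≤ q·w₁ = p`. (derived here) [cite: AbramovichTemkinWlodarczyk2024, §5.1 (p. 1575)] -/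
example : coeff (Finsupp.single 0 p) ((addPolyShear (1 : Fin 2) (X 0 ^ p : MvPolynomial (Fin 2) k)).symm (X 1)) = -1 ∧
    coeff (Finsupp.single 0 1) ((addPolyShear (1 : Fin 2) (X 0 ^ p : MvPolynomial (Fin 2) k)).symm (X 1)) = 0 ∧
    ((p : ℕ) : ℚ) = (p ^ 2 : ℕ) * (![1 / ((p : ℚ) ^ 2 + 1), 1 / p] : Fin 2 → ℚ) 1 ∧
    (2 : ℚ) ≤ (p ^ 2 : ℕ) * (![1 / ((p : ℚ) ^ 2 + 1), 1 / p] : Fin 2 → ℚ) 1 := by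
  have hp0 : (p : ℚ) ≠ 0 := by exact_mod_cast hp.out.ne_zero
  have h1 : (![1 / ((p : ℚ) ^ 2 + 1), 1 / p] : Fin 2 → ℚ) 1 = 1 / p := rfl
  have hq : ((p ^ 2 : ℕ) : ℚ) * (1 / p) = p := by
    rw [Nat.cast_pow, pow_two, one_div, mul_assoc, mul_inv_cancel₀ hp0, mul_one]
  refine ⟨?_, ?_, ?_, ?_⟩
  · rw [coeff_single_addPolyShear_symm_X_one_fold, if_pos rfl]
  · rw [coeff_single_addPolyShear_symm_X_one_fold, if_neg hp.out.ne_one.symm]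
  · rw [h1, hq]
  · rw [h1, hq]
    exact_mod_cast hp.out.two_le

end Instance

end WeightedBlowup

end Literature.AlgebraicGeometry.Resolution
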